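import Summits.CriticalPhenomena.PercolationContinuityZ3.Theorems.PercShatteringRaceFreeSusceptibilityPowerSavingTypicalMaxBound
import Summits.CriticalPhenomena.PercolationContinuityZ3.Theorems.PercShatteringRaceFreeSusceptibilityPowerSavingRootedMeanBound
import HarnessLib

/-!
# Crux `PercShatteringRace.FreeSusceptibilityPowerSaving` = S(1/2) (stmt-CriticalPhenomena-5786), line `bk-hyperscaling-tail-transfer` — the LEVER: Hutchcroft's BK hyperscaling inequality (PTRF 181 (2021), Thm 2.5 ⊇ Thm 2.1), per-root, on an arbitrary weighted graph

Helper file of the line lead (prover-line-stmt-CriticalPhenomena-5786-0), `--supports stmt-CriticalPhenomena-5786`.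
It composes the two registered (and landed) halves of the lever,

* `stub_typicalMaxBound` — `(M-1)^{1+θ} ≤ e A |Λ|` from a root-uniform volume tail over `Λ`, and
* `stub_rootedMeanBound` — `Σ_{v∈Λ} P(u ↔ v) ≤ C(θ₀) A M^{1-θ}` from the tail at the root `u` alone
  (`M = typicalMax (prodBernoulli w) Λ`, Hutchcroft's typical maximum cluster size),

into the printed theorem, registered on the crux item as the stub `stub_hyperscalingBK` (Hutchcroft, *Power-law bounds for critical long-range percolation below the upper-critical
dimension*, PTRF 181 (2021) 533–570 = arXiv:2008.11197, Thm 2.1 p. 11 and Thm 2.5 p. 14, in the per-root form its proof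
yields): for every `θ₀ < 1` there is `C` such that on every countable weighted graph (`prodBernoulli w`, `w : Sym2 V → [0,1]`),
for every finite `Λ`, `0 ≤ θ ≤ θ₀`, `A ≥ 1`, a root-uniform tail `P(n ≤ |K_v ∩ Λ|) ≤ A n^{-θ}` (`v ∈ Λ`, `n ≥ 1`) forces
`Σ_{v∈Λ} P(u ↔ v) ≤ C A^{2/(1+θ)} |Λ|^{(1-θ)/(1+θ)}` for every `u ∈ Λ`.  The composition is rpow algebra:
`M ≤ 2(M-1)` (`M ≥ 2`), `M^{1-θ} ≤ 2 (M-1)^{1-θ} = 2((M-1)^{1+θ})^{(1-θ)/(1+θ)} ≤ 2e A^{(1-θ)/(1+θ)} |Λ|^{(1-θ)/(1+θ)}`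
and `A · A^{(1-θ)/(1+θ)} = A^{2/(1+θ)}`; constant `2eC(θ₀)`.  No definitions.
-/

noncomputable section

namespace Summit.CriticalPhenomena.PercolationContinuityZ3.Theorems

open MeasureTheory Finset
open Literature.Probability.Percolation Literature.Probability.LatticeModels

/-- **Hutchcroft's BK hyperscaling inequality (PTRF 181 (2021) = arXiv:2008.11197, Thm 2.5 ⊇ Thm 2.1), per-root
form on an arbitrary weighted graph.**  For every `θ₀ < 1` there is `C = C(θ₀) > 0` such that for every countable
vertex type `V`, every edge weight `w : Sym2 V → [0,1]`, every finite `Λ ⊆ V`, every `0 ≤ θ ≤ θ₀` and `A ≥ 1`: if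
`P(n ≤ |K_v ∩ Λ|) ≤ A n^{-θ}` for all `v ∈ Λ` and integers `n ≥ 1` (`|K_v ∩ Λ| = clusterCapIn Λ ω v`), then
`Σ_{v ∈ Λ} P(u ↔ v) ≤ C A^{2/(1+θ)} |Λ|^{(1-θ)/(1+θ)}` for every `u ∈ Λ` (printed: `|Λ|⁻¹ Σ_v ≤ C A^{2/(1+θ)} |Λ|^{-2θ/(1+θ)}`).
[cite: Hutchcroft2021, Thm 2.1 (p. 11), Thm 2.5 and its proof (p. 14)] -/
theorem stub_hyperscalingBK :
    ∀ θ₀ : ℝ, θ₀ < 1 → ∃ C : ℝ, 0 < C ∧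
      ∀ (V : Type) [Countable V] (w : Sym2 V → unitInterval) (Λ : Finset V) (θ A : ℝ),
      0 ≤ θ → θ ≤ θ₀ → 1 ≤ A →
      (∀ v ∈ Λ, ∀ n : ℕ, 1 ≤ n →
        (prodBernoulli w).real {ω | n ≤ clusterCapIn Λ ω v} ≤ A * (n : ℝ) ^ (-θ)) →
      ∀ u ∈ Λ, ∑ v ∈ Λ, (prodBernoulli w).real (openConn u v)
        ≤ C * A ^ (2 / (1 + θ)) * (Λ.card : ℝ) ^ ((1 - θ) / (1 + θ)) := by
  intro θ₀ hθ₀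
  obtain ⟨C, hC, HE⟩ := stub_rootedMeanBound θ₀ hθ₀
  refine ⟨2 * Real.exp 1 * C, by positivity, ?_⟩
  intro V _ w Λ θ A hθ hθθ₀ hA htail u hu
  have hΛ : Λ.Nonempty := ⟨u, hu⟩
  set M : ℕ := typicalMax (prodBernoulli w) Λ with hMdef
  have hM2 : 2 ≤ M := two_le_typicalMax _ hΛ
  have hM2R : (2 : ℝ) ≤ M := by exact_mod_cast hM2
  have hθ1 : θ < 1 := lt_of_le_of_lt hθθ₀ hθ₀
  have h1θ : 0 < 1 + θ := by linarith
  have hA0 : 0 ≤ A := by linarith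
  -- the two landed halves
  have hmax : ((M : ℝ) - 1) ^ (1 + θ) ≤ Real.exp 1 * A * (Λ.card : ℝ) :=
    stub_typicalMaxBound V w Λ θ A hθ hA hΛ htail
  have hmean : ∑ v ∈ Λ, (prodBernoulli w).real (openConn u v) ≤ C * A * (M : ℝ) ^ (1 - θ) :=
    HE V w Λ θ A hθ hθθ₀ hA u hu (htail u hu)
  -- exponent bookkeeping
  set r : ℝ := (1 - θ) / (1 + θ) with hr
  have hr0 : 0 ≤ r := div_nonneg (by linarith) h1θ.le
  have hr1 : r ≤ 1 := by rw [hr, div_le_iff₀ h1θ]; linarith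
  have hexp : (1 + θ) * r = 1 - θ := by rw [hr]; field_simp
  have h2q : 1 + r = 2 / (1 + θ) := by rw [hr]; field_simp; ring
  -- `M^{1-θ} ≤ 2 (M-1)^{1-θ}`
  have hM10 : (0 : ℝ) ≤ (M : ℝ) - 1 := by linarith
  have hstep1 : (M : ℝ) ^ (1 - θ) ≤ 2 * ((M : ℝ) - 1) ^ (1 - θ) := by
    have hle : (M : ℝ) ≤ 2 * ((M : ℝ) - 1) := by linarith
    calc (M : ℝ) ^ (1 - θ) ≤ (2 * ((M : ℝ) - 1)) ^ (1 - θ) :=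
          Real.rpow_le_rpow (by linarith) hle (by linarith)
      _ = (2 : ℝ) ^ (1 - θ) * ((M : ℝ) - 1) ^ (1 - θ) := Real.mul_rpow (by norm_num) hM10
      _ ≤ 2 * ((M : ℝ) - 1) ^ (1 - θ) := by
          refine mul_le_mul_of_nonneg_right ?_ (Real.rpow_nonneg hM10 _)
          have : (2 : ℝ) ^ (1 - θ) ≤ (2 : ℝ) ^ (1 : ℝ) :=
            Real.rpow_le_rpow_of_exponent_le (by norm_num) (by linarith)
          simpa using this
  -- `(M-1)^{1-θ} = ((M-1)^{1+θ})^r ≤ (e A |Λ|)^r ≤ e A^r |Λ|^r`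
  have hstep2 : ((M : ℝ) - 1) ^ (1 - θ) ≤ Real.exp 1 * A ^ r * (Λ.card : ℝ) ^ r := by
    have heq : ((M : ℝ) - 1) ^ (1 - θ) = (((M : ℝ) - 1) ^ (1 + θ)) ^ r := by
      rw [← Real.rpow_mul hM10, hexp]
    rw [heq]
    have hnn : 0 ≤ ((M : ℝ) - 1) ^ (1 + θ) := Real.rpow_nonneg hM10 _
    calc (((M : ℝ) - 1) ^ (1 + θ)) ^ r ≤ (Real.exp 1 * A * (Λ.card : ℝ)) ^ r :=
          Real.rpow_le_rpow hnn hmax hr0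
      _ = Real.exp 1 ^ r * A ^ r * (Λ.card : ℝ) ^ r := by
          rw [Real.mul_rpow (by positivity) (Nat.cast_nonneg _),
            Real.mul_rpow (Real.exp_pos _).le hA0]
      _ ≤ Real.exp 1 * A ^ r * (Λ.card : ℝ) ^ r := by
          have he1 : (1 : ℝ) ≤ Real.exp 1 := Real.one_le_exp zero_le_one
          have : Real.exp 1 ^ r ≤ Real.exp 1 ^ (1 : ℝ) :=
            Real.rpow_le_rpow_of_exponent_le he1 hr1
          rw [Real.rpow_one] at this
          gcongr
  -- assemble
  have hAr : A * A ^ r = A ^ (2 / (1 + θ)) := by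
    rw [← h2q, Real.rpow_add (by linarith : (0 : ℝ) < A), Real.rpow_one]
  calc ∑ v ∈ Λ, (prodBernoulli w).real (openConn u v) ≤ C * A * (M : ℝ) ^ (1 - θ) := hmean
    _ ≤ C * A * (2 * (Real.exp 1 * A ^ r * (Λ.card : ℝ) ^ r)) := by
        have : (M : ℝ) ^ (1 - θ) ≤ 2 * (Real.exp 1 * A ^ r * (Λ.card : ℝ) ^ r) :=
          hstep1.trans (by linarith [hstep2])
        exact mul_le_mul_of_nonneg_left this (by positivity)
    _ = 2 * Real.exp 1 * C * (A * A ^ r) * (Λ.card : ℝ) ^ r := by ring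
    _ = 2 * Real.exp 1 * C * A ^ (2 / (1 + θ)) * (Λ.card : ℝ) ^ ((1 - θ) / (1 + θ)) := by
        rw [hAr]

end Summit.CriticalPhenomena.PercolationContinuityZ3.Theorems

end
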